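import Literature.Probability.RandomPlanarGeometry.SAWCountMonotoneReversal
import HarnessLib

/-!
# Monotonicity `cₙ ≤ cₙ₊₁` (O'Brien 1990): masts — folding at a top visit with a straight run of any
# length, and the length-preserving «retract-fold»

Sequel of `BDGS2012CountMonoOps.lean` (`foldAt k t ω`: keep `ω 0, …, ω t` at a time `t` where the
`k`-coordinate is maximal, make one step `+eₖ`, continue with the reflection of the rest — always
self-avoiding, `foldAt_mem_saws`; `dblAt k s ω`: double a cut step — always self-avoiding,
`dblAt_mem_saws`) and `BDGS2012CountMonoExt.lean` (`restrictTo`, `restrictTo_mem_saws`).  Iterating the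
doubling at the cut created by the fold gives a MAST of any length `m + 1` on top of the walk's extreme
hyperplane; cutting the result back to `n` steps gives the **retract-fold** maps `ω ↦ Uₘ(ω)` — `n`-step
self-avoiding walks again, for EVERY `n`-step self-avoiding walk, every coordinate, every top visit and
every mast length.  These are the image families of the lane's repair-map experiments for the doubly
trapped walks (lane note `OBRIEN-DESIGN-2.md` §6–§7: the least-`m` retract-fold beats every «double
spiral», and spreading each doubly trapped walk uniformly over its retract-fold images with `m ≤ 2`
loads no image above a quarter of its spare capacity on `ℤ²` up to `n = 19`), to be fed into
`count_le_count_succ_of_fractional` (`SAWCountMonotoneFractional.lean`).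

* `mastFold k t m ω = (dblAt k t)^[m] (foldAt k t ω)`; `mastFold_mem_saws_and_cut` / `mastFold_mem_saws` :
  for `ω ∈ saws d n`, `t ≤ n` a top visit in coordinate `k`, and any `m`, an `(n + 1 + m)`-step
  self-avoiding walk with a cut at `t`;
* `restrictTo_add_mem_saws` : restricting an `(n + j)`-step self-avoiding walk to `[0, n]`;
* `retractFold k t m n ω = restrictTo (mastFold k t m ω) n`; `retractFold_mem_saws` : **an `n`-step
  self-avoiding walk, for every top visit `t` and every mast length** (the walk's last `m + 1` steps are
  traded for a straight mast of `m + 1` steps at its extreme hyperplane, the part in between reflected).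

[cite: MadrasSlade1993, §3.1 (reflection in a lattice hyperplane), §7.1] [cite: BDGS2012, §1.3 (`cₙ ≤ cₙ₊₁`, O'Brien 1990)]
-/

noncomputable section

open Literature.Probability.LatticeModels Literature.Probability.Percolation SimpleGraph

namespace Literature.Probability.RandomPlanarGeometry.SAW.Zd

variable {d : ℕ}

/-! ### Masts -/

/-- The fold at time `t` in coordinate `k` followed by `m` doublings of the cut it creates: the walk
`ω 0, …, ω t`, a straight mast of `m + 1` steps `+eₖ`, then the reflected remainder translated on top
of the mast. [cite: MadrasSlade1993, §7.1] -/
def mastFold (k : Fin d) (t m : ℕ) (ω : ℕ → Site d) : ℕ → Site d :=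
  (dblAt k t)^[m] (foldAt k t ω)

/-- `mastFold k t 0 = foldAt k t`. [cite: MadrasSlade1993, §7.1] -/
theorem mastFold_zero (k : Fin d) (t : ℕ) (ω : ℕ → Site d) : mastFold k t 0 ω = foldAt k t ω := rfl

/-- One more doubling. [cite: MadrasSlade1993, §7.1] -/
theorem mastFold_succ (k : Fin d) (t m : ℕ) (ω : ℕ → Site d) :
    mastFold k t (m + 1) ω = dblAt k t (mastFold k t m ω) := by
  rw [mastFold, mastFold, Function.iterate_succ_apply']

/-- **A mast of any length on a top visit is self-avoiding**, and keeps a cut at the folding time: for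
`ω ∈ saws d n`, `t ≤ n` with `ω i k ≤ ω t k` for all `i ≤ n`, the walk `mastFold k t m ω` is an
`(n + 1 + m)`-step self-avoiding walk whose step `t → t+1` is `+eₖ`, with `xₖ ≤ ω t k` up to time `t`
and `xₖ ≥ ω t k + 1` from time `t + 1` on. [cite: MadrasSlade1993, §7.1] -/
theorem mastFold_mem_saws_and_cut {k : Fin d} {n t : ℕ} {ω : ℕ → Site d} (hω : ω ∈ saws d n)
    (ht : t ≤ n) (hmax : ∀ i ≤ n, ω i k ≤ ω t k) (m : ℕ) :
    mastFold k t m ω ∈ saws d (n + 1 + m) ∧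
      mastFold k t m ω (t + 1) = mastFold k t m ω t + Pi.single k 1 ∧
      (∀ i ≤ t, mastFold k t m ω i k ≤ mastFold k t m ω t k) ∧
      (∀ i, t + 1 ≤ i → i ≤ n + 1 + m → mastFold k t m ω t k + 1 ≤ mastFold k t m ω i k) := by
  induction m with
  | zero =>
    rw [mastFold_zero, Nat.add_zero]
    have ht0 : foldAt k t ω t = ω t := foldAt_of_le le_rfl
    refine ⟨foldAt_mem_saws hω ht hmax, ?_, ?_, ?_⟩
    · rw [foldAt_succ le_rfl, ht0, reflK_of_apply_eq k rfl]
    · intro i hi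
      rw [foldAt_of_le hi, ht0]
      exact hmax i (hi.trans ht)
    · intro i hi hin
      rw [ht0, foldAt_apply_k, if_neg (by omega)]
      have := hmax (i - 1) (by omega)
      omega
  | succ m ih =>
    obtain ⟨hmem, hstep, hpast, hfut⟩ := ih
    have ht' : mastFold k t (m + 1) ω t = mastFold k t m ω t := by
      rw [mastFold_succ, dblAt_of_le (Nat.le_succ t)]
    refine ⟨?_, ?_, ?_, ?_⟩
    · rw [mastFold_succ, show n + 1 + (m + 1) = n + 1 + m + 1 by omega]
      exact dblAt_mem_saws hmem (by omega) hstep hpast hfut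
    · rw [ht', mastFold_succ, dblAt_of_le le_rfl, hstep]
    · intro i hi
      rw [ht', mastFold_succ, dblAt_of_le (by omega)]
      exact hpast i hi
    · intro i hi hin
      rw [ht', mastFold_succ, dblAt_apply_k]
      by_cases hle : i ≤ t + 1
      · rw [if_pos hle]
        obtain rfl : i = t + 1 := le_antisymm hle hi
        have := congrFun hstep k
        simp only [Pi.add_apply, Pi.single_eq_same] at this
        omega
      · rw [if_neg hle]
        have := hfut (i - 1) (by omega) (by omega)
        omega

/-- **A mast of any length on a top visit is self-avoiding.** [cite: MadrasSlade1993, §7.1] -/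
theorem mastFold_mem_saws {k : Fin d} {n t : ℕ} {ω : ℕ → Site d} (hω : ω ∈ saws d n) (ht : t ≤ n)
    (hmax : ∀ i ≤ n, ω i k ≤ ω t k) (m : ℕ) : mastFold k t m ω ∈ saws d (n + 1 + m) :=
  (mastFold_mem_saws_and_cut hω ht hmax m).1

/-! ### Retracting -/

/-- Restricting an `(n + j)`-step self-avoiding walk to `[0, n]` gives an `n`-step self-avoiding walk.
[cite: MadrasSlade1993, §1.1] -/
theorem restrictTo_add_mem_saws {n : ℕ} (j : ℕ) {q : ℕ → Site d} (hq : q ∈ saws d (n + j)) :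
    restrictTo q n ∈ saws d n := by
  induction j generalizing q with
  | zero =>
    have : restrictTo q n = q := by
      funext i
      rw [restrictTo_apply]
      rcases le_or_gt i n with hi | hi
      · rw [min_eq_left hi]
      · rw [min_eq_right hi.le]; exact ((mem_saws.1 hq).2.1 i hi.le).symm
    rw [this]; exact hq
  | succ j ih =>
    have h1 : restrictTo q (n + j) ∈ saws d (n + j) :=
      restrictTo_mem_saws (by rw [show n + j + 1 = n + (j + 1) by omega]; exact hq)
    have h2 := ih h1
    have : restrictTo (restrictTo q (n + j)) n = restrictTo q n := by
      funext i
      simp only [restrictTo_apply]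
      rw [min_eq_left ((min_le_right i n).trans (Nat.le_add_right n j))]
    rw [this] at h2
    exact h2

/-- The **retract-fold** `Uₘ`: fold at the top visit `t` with a mast of `m + 1` steps, then cut back to
`n` steps (the last `m + 1` steps of `ω` are traded for the mast). [cite: MadrasSlade1993, §7.1] -/
def retractFold (k : Fin d) (t m n : ℕ) (ω : ℕ → Site d) : ℕ → Site d :=
  restrictTo (mastFold k t m ω) n

/-- **The retract-fold of an `n`-step self-avoiding walk at any top visit, with any mast length, is an
`n`-step self-avoiding walk.** [cite: MadrasSlade1993, §7.1] [cite: BDGS2012, §1.3] -/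
theorem retractFold_mem_saws {k : Fin d} {n t : ℕ} {ω : ℕ → Site d} (hω : ω ∈ saws d n) (ht : t ≤ n)
    (hmax : ∀ i ≤ n, ω i k ≤ ω t k) (m : ℕ) : retractFold k t m n ω ∈ saws d n :=
  restrictTo_add_mem_saws (m + 1) (by
    rw [show n + (m + 1) = n + 1 + m by omega]; exact mastFold_mem_saws hω ht hmax m)

/-- The retract-fold keeps the walk up to the folding time. [cite: MadrasSlade1993, §7.1] -/
theorem retractFold_of_le {k : Fin d} {t m n : ℕ} {ω : ℕ → Site d} (ht : t ≤ n) {i : ℕ} (hi : i ≤ t) :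
    retractFold k t m n ω i = ω i := by
  rw [retractFold, restrictTo_apply, min_eq_left (hi.trans ht)]
  induction m with
  | zero => rw [mastFold_zero, foldAt_of_le hi]
  | succ m ih => rw [mastFold_succ, dblAt_of_le (by omega), ih]

end Literature.Probability.RandomPlanarGeometry.SAW.Zd
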